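import Literature.Analysis.FluidPDE.WholeSpaceIBP
import Literature.Analysis.FluidPDE.TaoEnstrophyLocalisationProofs
import Literature.Analysis.FluidPDE.LoopCirculation
import Literature.Analysis.FluidPDE.VorticityStretching
import Summits.NavierStokesRegularity.NavierStokesRegularity.Theorems.ThreadingFluxCentreVirialHodgeAlgebra
import HarnessLib

/-!
# Hodge slaving, sphere-free — II: the pointwise Bochner inequality for tangential fields

For `W ∈ C²` near `x ≠ x₀`, tangential about `x₀` (`⟪W z, z − x₀⟫ = 0`): `⟪DW h, y⟫ = −⟪W, h⟫` (`inner_fderiv_tangential`);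
unthreaded at `x` (`⟪curl W x, y⟫ = 0`) ⇒ `DW(x)` symmetric on `yᗮ` (`fderiv_symm_of_unthreaded`, from the tree's
`inner_curl_cross` and a triple-product identity); `div((W·∇)W) = tr(DW∘DW) + D(div W)[W]` (`divergence_convect_self`,
Schwarz); the BOCHNER FIELD `Q = (div W)W − (W·∇)W − (|W|²/|y|²)y` (`bochnerField`) is tangential
(`inner_bochnerField_self`) with `div Q = (div W)² − tr(DW∘DW) − |W|²/|y|² − 2|y|⁻²⟪W, DW y⟫` (`divergence_bochnerField`);
hence ★ `divergence_bochnerField_add_le`: `div Q + |W|²/|y|² ≤ ½ (div W)²` (the curvature term `|W|²/|y|²` of the round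
sphere `S_{|y|}` and the sharp `λ₁(S²) = 2` in pointwise, ambient form).

Part of the sphere-free proof of HODGE SLAVING FOR `C²` FIELDS (H′) behind ★ T2 `PoloidalTameLiouville` of the
centre-virial card (ns-idea-15 g9; twin `ThreadingFluxCentreVirialDefs`).  Folklore differential geometry / linear algebra,
re-derived in ambient coordinates; information-grade; W1 movement 0; `PoloidalLiouville` (1222), T0, Galdi's problem OPEN;
NS regularity is NOT proved.  `--supports stmt-NavierStokesRegularity-1222 --as helper`.  Filed by ns-wall-eng-4 g6
(cell ns-wall-extremal).
[cite: KorobkovPileckasRusso2015, Thm 3.6]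
-/

-- the summit and its single sub-problem share the name (CONVENTIONS §1)
set_option linter.dupNamespace false

noncomputable section

namespace Summit.NavierStokesRegularity.NavierStokesRegularity.Theorems.PoloidalLiouville.CentreVirial

open Set Function MeasureTheory Filter Topology
open Literature.Analysis.FluidPDE
open Literature.Analysis.FluidPDE.VectorCalculus (divergence)
open Summit.NavierStokesRegularity.NavierStokesRegularity.Theorems.PoloidalLiouville.CentreJet (E3)
open scoped RealInnerProductSpace

namespace Hodge

/-- (P1) For a tangential field, `⟪DW(x) h, y⟫ = −⟪W x, h⟫`. -/
theorem inner_fderiv_tangential {W : E3 → E3} {x₀ x : E3} (hW : DifferentiableAt ℝ W x)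
    (htan : ∀ z, ⟪W z, z - x₀⟫ = 0) (h : E3) :
    ⟪fderiv ℝ W x h, x - x₀⟫ = -⟪W x, h⟫ := by
  have hy : DifferentiableAt ℝ (fun z : E3 => z - x₀) x := differentiableAt_id.sub_const x₀
  have hzero : (fun z : E3 => ⟪W z, z - x₀⟫) = fun _ => (0 : ℝ) := funext htan
  have hd : fderiv ℝ (fun z : E3 => ⟪W z, z - x₀⟫) x h = 0 := by
    rw [hzero, fderiv_const_apply, _root_.zero_apply]
  rw [fderiv_inner_apply ℝ hW hy, fderiv_sub_const, fderiv_fun_id, ContinuousLinearMap.id_apply] at hd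
  linarith

/-- The scalar triple-product identity `⟪a × b, c⟫ |y|² = ⟪y,a⟫⟪b × c, y⟫ + ⟪y,b⟫⟪c × a, y⟫ + ⟪y,c⟫⟪a × b, y⟫`. -/
theorem triple_product_expand (a b c y : E3) :
    ⟪cross a b, c⟫ * ‖y‖ ^ 2 =
      ⟪y, a⟫ * ⟪cross b c, y⟫ + ⟪y, b⟫ * ⟪cross c a, y⟫ + ⟪y, c⟫ * ⟪cross a b, y⟫ := by
  rw [← real_inner_self_eq_norm_sq]
  simp only [cross, PiLp.inner_apply, cross_apply, RCLike.inner_apply, conj_trivial,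
    Fin.sum_univ_three, Matrix.cons_val_zero, Matrix.cons_val_one, Matrix.cons_val_two,
    Matrix.head_cons, Matrix.tail_cons]
  ring

/-- (P5) Unthreaded + tangential directions ⇒ `DW(x)` is symmetric on `yᗮ`. -/
theorem fderiv_symm_of_unthreaded {W : E3 → E3} {x₀ x : E3} (hy : x - x₀ ≠ 0)
    (hcurl : ⟪curl W x, x - x₀⟫ = 0) (a b : E3) (ha : ⟪a, x - x₀⟫ = 0) (hb : ⟪b, x - x₀⟫ = 0) :
    ⟪fderiv ℝ W x a, b⟫ = ⟪fderiv ℝ W x b, a⟫ := by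
  have h := inner_curl_cross W x a b
  have ht := triple_product_expand a b (curl W x) (x - x₀)
  have ha' : ⟪x - x₀, a⟫ = 0 := by rw [real_inner_comm]; exact ha
  have hb' : ⟪x - x₀, b⟫ = 0 := by rw [real_inner_comm]; exact hb
  have hc' : ⟪x - x₀, curl W x⟫ = 0 := by rw [real_inner_comm]; exact hcurl
  rw [ha', hb', hc', zero_mul, zero_mul, zero_mul, add_zero, add_zero] at ht
  have hn : ‖x - x₀‖ ^ 2 ≠ 0 := pow_ne_zero 2 (norm_ne_zero_iff.2 hy)
  have h0 : ⟪cross a b, curl W x⟫ = 0 := by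
    rcases mul_eq_zero.1 ht with h1 | h1
    · exact h1
    · exact absurd h1 hn
  rw [real_inner_comm] at h0
  linarith [h, h0]

/-- (P7b) `div((W·∇)W)(x) = tr(DW ∘ DW) + D(div W)(x)(W x)` for `W ∈ C²` near `x`. -/
theorem divergence_convect_self {W : E3 → E3} {x : E3} (hW : ContDiffAt ℝ 2 W x) :
    divergence (convect W W) x =
      LinearMap.trace ℝ E3 ((fderiv ℝ W x : E3 →ₗ[ℝ] E3) ∘ₗ (fderiv ℝ W x : E3 →ₗ[ℝ] E3)) +
        fderiv ℝ (divergence W) x (W x) := by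
  -- `DW` is differentiable at `x`
  obtain ⟨u, hu, hW2⟩ := hW.contDiffOn le_rfl (by simp)
  have hW1 : DifferentiableAt ℝ W x := hW.differentiableAt (by simp)
  have hDW : DifferentiableAt ℝ (fderiv ℝ W) x := by
    have := hW.fderiv_right (m := 1) (by norm_num)
    exact this.differentiableAt one_ne_zero
  -- derivative of the convective term
  have hconv : convect W W = fun y => (fderiv ℝ W y) (W y) := rfl
  have e1 : fderiv ℝ (convect W W) x = (fderiv ℝ W x).comp (fderiv ℝ W x) + (fderiv ℝ (fderiv ℝ W) x).flip (W x) := by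
    rw [hconv, fderiv_clm_apply hDW hW1]
  -- symmetry of the second derivative
  have hS : ∀ a c, fderiv ℝ (fderiv ℝ W) x a c = fderiv ℝ (fderiv ℝ W) x c a := fun a c =>
    (hW.isSymmSndFDerivAt (n := 2) (by simp)) a c
  have e2 : (fderiv ℝ (fderiv ℝ W) x).flip (W x) = fderiv ℝ (fderiv ℝ W) x (W x) := by
    ext a i
    rw [ContinuousLinearMap.flip_apply, hS]
  -- derivative of the divergence
  have e3 : fderiv ℝ (divergence W) x (W x) = traceCLM (fderiv ℝ (fderiv ℝ W) x (W x)) := by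
    have h : divergence W = (traceCLM : (E3 →L[ℝ] E3) →L[ℝ] ℝ) ∘ fderiv ℝ W :=
      funext (divergence_eq_traceCLM W)
    rw [h, (traceCLM.hasFDerivAt.comp x hDW.hasFDerivAt).fderiv]
    rfl
  rw [divergence_eq_traceCLM, e1, map_add, e2, e3, traceCLM_apply]
  rfl

/-- (P7c) `div(|W|²/|y|² · y) = |W|²/|y|² + 2|y|⁻² ⟪W, DW y⟫` off the centre. -/
theorem divergence_normSq_div_smul {W : E3 → E3} {x₀ x : E3} (hW : DifferentiableAt ℝ W x) (hy : x - x₀ ≠ 0) :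
    divergence (fun z => ((‖z - x₀‖ ^ 2)⁻¹ * ‖W z‖ ^ 2) • (z - x₀)) x =
      ‖W x‖ ^ 2 / ‖x - x₀‖ ^ 2 + 2 * (‖x - x₀‖ ^ 2)⁻¹ * ⟪W x, fderiv ℝ W x (x - x₀)⟫ := by
  have hn : ‖x - x₀‖ ^ 2 ≠ 0 := pow_ne_zero 2 (norm_ne_zero_iff.2 hy)
  have hyd : DifferentiableAt ℝ (fun z : E3 => z - x₀) x := differentiableAt_id.sub_const x₀
  have h1 : HasFDerivAt (fun z : E3 => z - x₀) (ContinuousLinearMap.id ℝ E3) x := (hasFDerivAt_id x).sub_const x₀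
  have h2 := h1.norm_sq                                       -- D|y|² = 2⟪y, ·⟫
  have h3 := (hasDerivAt_inv hn).comp_hasFDerivAt x h2        -- D(|y|²)⁻¹
  have h4 := hW.hasFDerivAt.norm_sq                           -- D|W|² = 2⟪W, DW ·⟫
  have h5' := h3.mul h4
  have h5 : HasFDerivAt (fun z : E3 => (‖z - x₀‖ ^ 2)⁻¹ * ‖W z‖ ^ 2)
      ((‖x - x₀‖ ^ 2)⁻¹ • ((2 : ℕ) • (innerSL ℝ (W x)).comp (fderiv ℝ W x)) +
        ‖W x‖ ^ 2 • (-((‖x - x₀‖ ^ 2) ^ 2)⁻¹ • ((2 : ℕ) • (innerSL ℝ (x - x₀)).comp (ContinuousLinearMap.id ℝ E3)))) x :=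
    h5'
  have hθd : DifferentiableAt ℝ (fun z : E3 => (‖z - x₀‖ ^ 2)⁻¹ * ‖W z‖ ^ 2) x := h5.differentiableAt
  rw [divergence_smul_apply hθd hyd]
  have hdiv3 : divergence (fun z : E3 => z - x₀) x = 3 := by
    unfold VectorCalculus.divergence
    rw [fderiv_sub_const, fderiv_fun_id]
    have ht := LinearMap.trace_id ℝ E3
    rw [finrank_euclideanSpace_fin] at ht
    exact_mod_cast ht
  rw [hdiv3, ← real_inner_comm, gradient, InnerProductSpace.toDual_symm_apply, h5.fderiv]
  simp only [_root_.add_apply, _root_.smul_apply, smul_eq_mul,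
    ContinuousLinearMap.comp_apply, ContinuousLinearMap.id_apply, innerSL_apply_apply,
    real_inner_self_eq_norm_sq]
  field_simp
  ring

/-- The Bochner flux field `Q = (div W) W − (W·∇)W − (|W|²/|y|²) y`. -/
def bochnerField (x₀ : E3) (W : E3 → E3) (z : E3) : E3 :=
  divergence W z • W z - convect W W z - ((‖z - x₀‖ ^ 2)⁻¹ * ‖W z‖ ^ 2) • (z - x₀)

/-- (P8) The Bochner field of a tangential field is tangential. -/
theorem inner_bochnerField_self {W : E3 → E3} {x₀ x : E3} (hW : DifferentiableAt ℝ W x)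
    (htan : ∀ z, ⟪W z, z - x₀⟫ = 0) (hy : x - x₀ ≠ 0) : ⟪bochnerField x₀ W x, x - x₀⟫ = 0 := by
  have hn : ‖x - x₀‖ ^ 2 ≠ 0 := pow_ne_zero 2 (norm_ne_zero_iff.2 hy)
  unfold bochnerField
  rw [inner_sub_left, inner_sub_left, real_inner_smul_left, real_inner_smul_left, convect_apply,
    inner_fderiv_tangential hW htan, htan x, real_inner_self_eq_norm_sq, real_inner_self_eq_norm_sq]
  field_simp
  ring

/-- (P7) **Pointwise Bochner identity** for a field `W ∈ C²` near `x ≠ x₀`: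
`div Q = (div W)² − tr(DW∘DW) − |W|²/|y|² − 2|y|⁻²⟪W, DW y⟫`. -/
theorem divergence_bochnerField {W : E3 → E3} {x₀ x : E3} (hW : ContDiffAt ℝ 2 W x) (hy : x - x₀ ≠ 0) :
    divergence (bochnerField x₀ W) x =
      divergence W x ^ 2 - LinearMap.trace ℝ E3 ((fderiv ℝ W x : E3 →ₗ[ℝ] E3) ∘ₗ (fderiv ℝ W x : E3 →ₗ[ℝ] E3)) -
        ‖W x‖ ^ 2 / ‖x - x₀‖ ^ 2 - 2 * (‖x - x₀‖ ^ 2)⁻¹ * ⟪W x, fderiv ℝ W x (x - x₀)⟫ := by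
  have hn : ‖x - x₀‖ ^ 2 ≠ 0 := pow_ne_zero 2 (norm_ne_zero_iff.2 hy)
  have hW1 : DifferentiableAt ℝ W x := hW.differentiableAt (by simp)
  have hDW : DifferentiableAt ℝ (fderiv ℝ W) x :=
    (hW.fderiv_right (m := 1) (by norm_num)).differentiableAt one_ne_zero
  have hdivd : DifferentiableAt ℝ (divergence W) x := by
    have h : divergence W = (traceCLM : (E3 →L[ℝ] E3) →L[ℝ] ℝ) ∘ fderiv ℝ W := funext (divergence_eq_traceCLM W)
    rw [h]
    exact traceCLM.differentiableAt.comp x hDW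
  have hconvd : DifferentiableAt ℝ (convect W W) x := by
    have hconv : convect W W = fun y => (fderiv ℝ W y) (W y) := rfl
    rw [hconv]
    exact hDW.clm_apply hW1
  have hyd : DifferentiableAt ℝ (fun z : E3 => z - x₀) x := differentiableAt_id.sub_const x₀
  have hθd : DifferentiableAt ℝ (fun z : E3 => (‖z - x₀‖ ^ 2)⁻¹ * ‖W z‖ ^ 2) x := by
    have h1 : HasFDerivAt (fun z : E3 => z - x₀) (ContinuousLinearMap.id ℝ E3) x := (hasFDerivAt_id x).sub_const x₀
    exact (((hasDerivAt_inv hn).comp_hasFDerivAt x h1.norm_sq).mul hW1.hasFDerivAt.norm_sq).differentiableAt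
  -- additivity of the divergence at a point
  have hsub : ∀ f g : E3 → E3, DifferentiableAt ℝ f x → DifferentiableAt ℝ g x →
      divergence (fun y => f y - g y) x = divergence f x - divergence g x := by
    intro f g hf hg
    unfold VectorCalculus.divergence
    rw [fderiv_fun_sub hf hg, ContinuousLinearMap.toLinearMap_sub, map_sub]
  have e0 : bochnerField x₀ W = fun z => (divergence W z • W z - convect W W z) -
      ((‖z - x₀‖ ^ 2)⁻¹ * ‖W z‖ ^ 2) • (z - x₀) := rfl
  have H3 : DifferentiableAt ℝ (fun z => divergence W z • W z) x := hdivd.smul hW1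
  have H1 : DifferentiableAt ℝ (fun z => divergence W z • W z - convect W W z) x := H3.sub hconvd
  have H2 : DifferentiableAt ℝ (fun z => ((‖z - x₀‖ ^ 2)⁻¹ * ‖W z‖ ^ 2) • (z - x₀)) x := hθd.smul hyd
  rw [e0, hsub _ _ H1 H2, hsub _ _ H3 hconvd,
    divergence_smul_apply hdivd hW1, divergence_convect_self hW, divergence_normSq_div_smul hW1 hy,
    ← real_inner_comm (W x), gradient, InnerProductSpace.toDual_symm_apply]
  ring

/-- ★ **The pointwise Bochner inequality**: for `W ∈ C²` near `x ≠ x₀`, tangential about `x₀` and unthreaded at `x`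
(`⟪curl W x, x − x₀⟫ = 0`), `div Q (x) + |W x|²/|x − x₀|² ≤ ½ (div W x)²`. -/
theorem divergence_bochnerField_add_le {W : E3 → E3} {x₀ x : E3} (hW : ContDiffAt ℝ 2 W x) (hy : x - x₀ ≠ 0)
    (htan : ∀ z, ⟪W z, z - x₀⟫ = 0) (hcurl : ⟪curl W x, x - x₀⟫ = 0) :
    divergence (bochnerField x₀ W) x + ‖W x‖ ^ 2 / ‖x - x₀‖ ^ 2 ≤ (1 / 2) * divergence W x ^ 2 := by
  have hW1 : DifferentiableAt ℝ W x := hW.differentiableAt (by simp)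
  have hA : ∀ h, ⟪(fderiv ℝ W x : E3 →ₗ[ℝ] E3) h, x - x₀⟫ = -⟪W x, h⟫ := fun h =>
    inner_fderiv_tangential hW1 htan h
  have hsym : ∀ a b : E3, ⟪a, x - x₀⟫ = 0 → ⟪b, x - x₀⟫ = 0 →
      ⟪(fderiv ℝ W x : E3 →ₗ[ℝ] E3) a, b⟫ = ⟪(fderiv ℝ W x : E3 →ₗ[ℝ] E3) b, a⟫ := fun a b ha hb =>
    fderiv_symm_of_unthreaded hy hcurl a b ha hb
  have key := half_trace_sq_le hy (htan x) hA hsym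
  have htr : LinearMap.trace ℝ E3 (fderiv ℝ W x : E3 →ₗ[ℝ] E3) = divergence W x := rfl
  rw [htr] at key
  rw [divergence_bochnerField hW hy]
  have : (fderiv ℝ W x : E3 →ₗ[ℝ] E3) (x - x₀) = fderiv ℝ W x (x - x₀) := rfl
  rw [this] at key
  linarith


end Hodge

end Summit.NavierStokesRegularity.NavierStokesRegularity.Theorems.PoloidalLiouville.CentreVirial
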